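import Summits.ValiantsHypothesis.ValiantsHypothesis.Theses.FeketeSOS
import Summits.ValiantsHypothesis.ValiantsHypothesis.Theorems.FeketeNoSparseSplit.Negative.SmallModels

/-!
# `FeketeNoSparseSplit` (crux stmt-ValiantsHypothesis-3997): the exponent `1/2 + δ` cannot reach `δ = 1/2`

Negative-side boundary lemma (cdisprove cycle 2, refuter-cdisprove-stmt-ValiantsHypothesis-3997-g2-0), PROVED, no new
facts: the crux's inner statement with `δ = 1/2` plugged in,
`∃ p₀, ∀ primes p ≥ p₀, ∀ A B, A·B = F_p → p^{1/2 + 1/2} ≤ |supp A| + |supp B|`,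
is FALSE — by the landed `not_eventuallyTrivialOptimal` (the `(X-1)`-peel has support-sum `≤ p - 1` at every
prime `p ≡ 1 (mod 4)`).  Together with the line `cyclic-valuation-dichotomy` (`(p+3)/2`, i.e. every `δ < 1/2`
works) this pins the set of admissible exponents of the crux to exactly `0 < δ < 1/2`: the statement is sharp in
`δ` up to the endpoint, and no strengthening of the conclusion to `p ≤ |supp A| + |supp B|` (eventually) survives.
-/

namespace Summit.ValiantsHypothesis.Theorems.FeketeNoSparseSplit.Negative

open Polynomial

/-- **The crux at `δ = 1/2` is false**: there is no `p₀` beyond which every complex splitting `A·B = F_p` has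
`p^{1/2+1/2} = p ≤ |supp A| + |supp B|` (peel splittings of support-sum `≤ p - 1` at all primes `p ≡ 1 (4)`,
`not_eventuallyTrivialOptimal`).  So `δ < 1/2` in any proof of `FeketeSOS.FeketeNoSparseSplit` is not an artefact. [folklore] -/
theorem feketeNoSparseSplit_false_at_delta_half :
    ¬ ∃ p₀ : ℕ, ∀ (p : ℕ) [Fact p.Prime], p₀ ≤ p → ∀ (A B : ℂ[X]),
      A * B = ∑ m ∈ Finset.range p, C ((legendreSym p m : ℤ) : ℂ) * X ^ m →
        (p : ℝ) ^ (1 / 2 + 1 / 2 : ℝ) ≤ (A.support.card : ℝ) + (B.support.card : ℝ) := by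
  rintro ⟨p₀, H⟩
  apply not_eventuallyTrivialOptimal
  refine ⟨p₀, ?_⟩
  intro p _ hp A B hAB
  have h := H p hp A B hAB
  have hhalf : (1 / 2 + 1 / 2 : ℝ) = 1 := by norm_num
  rwa [hhalf, Real.rpow_one] at h

end Summit.ValiantsHypothesis.Theorems.FeketeNoSparseSplit.Negative
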